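import Mathlib

/-!
# Successive approximation for the norm `x ↦ x · σ x` modulo powers of a fixed uniformiser

The algebraic core of «`N(O_{E_v}^×) = O_{F_v}^×` at an unramified place» (local class field theory
for the unramified quadratic extension; route/T5-route-2.md's «η_v = the norm character» / the
unramified half of the norm index theorem): for a commutative domain `S` with a ring involution `σ`
and an element `ϖ` fixed by `σ` (the common uniformiser of `R ⊆ S`), if the residue-level norm and
trace are surjective — hypotheses `hres` / `htr`, discharged on finite residue fields in
`T5UnramifiedNormResidue` — then for every `σ`-fixed unit `u` and every `n ≥ 1` there is a unit `x`
with `x · σ x ≡ u (mod ϖ^n)` (`exists_units_normConj_sub_dvd`).  The identity behind the step is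
`N(x (1 + ϖ^n t)) = N x · (1 + ϖ^n (t + σ t) + ϖ^{2n} N t)`.

The passage to an exact solution (`N x = u`) is a compactness / completeness statement and is made
on Mathlib's completions in `T5AdicCompletionNormSurjective`.

Declaration per README §8(d): «uses an L-value-free non-vanishing device: NO».
-/

namespace Summit.Ventures.HodgeRepro2.T5UnramifiedNormApprox

variable {S : Type*} [CommRing S] (σ : S ≃+* S)

/-- The norm `N x = x · σ x` attached to the involution `σ`. -/
def normConj (x : S) : S := x * σ x

/-- Unfolding `normConj`. -/
theorem normConj_apply (x : S) : normConj σ x = x * σ x := rfl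

/-- `N` is multiplicative. -/
theorem normConj_mul (x y : S) : normConj σ (x * y) = normConj σ x * normConj σ y := by
  simp only [normConj, map_mul]; ring

/-- `N 1 = 1`. -/
theorem normConj_one : normConj σ (1 : S) = 1 := by simp [normConj]

/-- `N x` is fixed by `σ` when `σ` is an involution. -/
theorem conj_normConj (hσσ : ∀ s, σ (σ s) = s) (x : S) : σ (normConj σ x) = normConj σ x := by
  simp only [normConj, map_mul, hσσ]; ring

/-- `N x` is a unit when `x` is. -/
theorem isUnit_normConj {x : S} (hx : IsUnit x) : IsUnit (normConj σ x) :=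
  hx.mul (hx.map σ)

/-- The norm of a unit as a unit. -/
theorem normConj_units_eq (x : Sˣ) :
    normConj σ (x : S) = ((x * Units.map (σ : S →* S) x : Sˣ) : S) := by
  simp [normConj]

/-- `N (1 + t) = 1 + (t + σ t) + N t`. -/
theorem normConj_one_add (t : S) : normConj σ (1 + t) = 1 + (t + σ t) + normConj σ t := by
  simp only [normConj, map_add, map_one]; ring

section Step

variable [IsDomain S]

/-- An element `d` with `ϖ^n d` fixed by `σ` is fixed by `σ` (`ϖ ≠ 0` fixed by `σ`). -/
theorem conj_eq_of_pow_mul {ϖ : S} (hϖ : σ ϖ = ϖ) (hϖ0 : ϖ ≠ 0) {n : ℕ} {d : S}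
    (h : σ (ϖ ^ n * d) = ϖ ^ n * d) : σ d = d := by
  rw [map_mul, map_pow, hϖ] at h
  exact mul_left_cancel₀ (pow_ne_zero n hϖ0) h

/-- ONE STEP of the successive approximation: if `N x ≡ u (mod ϖ^n)` for a unit `x` and a `σ`-fixed
`u`, then `x' := x (1 + ϖ^n t)` satisfies `N x' ≡ u (mod ϖ^{n+1})` for a suitable `t` (supplied by
the residue-level trace surjectivity `htr`), and `x' ≡ x (mod ϖ^n)`. -/
theorem exists_mul_one_add_normConj_sub_dvd_succ (hσσ : ∀ s, σ (σ s) = s) {ϖ : S} (hϖ : σ ϖ = ϖ)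
    (hϖ0 : ϖ ≠ 0) (htr : ∀ c : S, σ c = c → ∃ t : S, ϖ ∣ (t + σ t) - c)
    {u : S} (hu : σ u = u) (x : Sˣ) {n : ℕ} (hn : 1 ≤ n)
    (h : ϖ ^ n ∣ normConj σ (x : S) - u) :
    ∃ t : S, ϖ ^ (n + 1) ∣ normConj σ ((x : S) * (1 + ϖ ^ n * t)) - u := by
  obtain ⟨d, hd⟩ := h
  -- the unit `N x` and its inverse
  set N : S := normConj σ (x : S) with hN
  have hNfix : σ N = N := conj_normConj σ hσσ _
  obtain ⟨Ninv, hNinv⟩ : ∃ Ninv : S, N * Ninv = 1 :=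
    ⟨((x⁻¹ : Sˣ) : S) * σ ((x⁻¹ : Sˣ) : S), by
      simp only [hN, normConj]
      have : (x : S) * σ (x : S) * ((x⁻¹ : Sˣ) * σ (x⁻¹ : Sˣ)) =
          ((x : S) * (x⁻¹ : Sˣ)) * σ ((x : S) * (x⁻¹ : Sˣ)) := by
        rw [map_mul]; ring
      rw [this]; simp⟩
  -- `d` is fixed by `σ`
  have hdfix : σ d = d := by
    apply conj_eq_of_pow_mul σ hϖ hϖ0 (n := n)
    rw [← hd, map_sub, hNfix, hu]
  -- the inverse of `N` is fixed by `σ`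
  have hNinvfix : σ Ninv = Ninv := by
    have h1 : N * σ Ninv = 1 := by
      have := congrArg σ hNinv
      rwa [map_mul, map_one, hNfix] at this
    calc σ Ninv = (N * Ninv) * σ Ninv := by rw [hNinv, one_mul]
      _ = (N * σ Ninv) * Ninv := by ring
      _ = Ninv := by rw [h1, one_mul]
  -- the target `c := - d · N⁻¹` is fixed by `σ`
  obtain ⟨t, e, he⟩ := htr (-d * Ninv) (by rw [map_mul, map_neg, hdfix, hNinvfix])
  refine ⟨t, ?_⟩
  have hc : N * (-d * Ninv) = -d := by
    calc N * (-d * Ninv) = -d * (N * Ninv) := by ring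
      _ = -d := by rw [hNinv, mul_one]
  -- the explicit identity
  have key : normConj σ ((x : S) * (1 + ϖ ^ n * t)) - u =
      ϖ ^ (n + 1) * (N * e) + ϖ ^ (2 * n) * (N * (t * σ t)) := by
    simp only [hN, normConj, map_mul, map_add, map_one, map_pow, hϖ] at hd hc ⊢
    linear_combination hd + (ϖ ^ n * ((x : S) * σ (x : S))) * he + ϖ ^ n * hc
  rw [key]
  refine dvd_add (dvd_mul_right _ _) (Dvd.dvd.mul_right ?_ _)
  exact pow_dvd_pow ϖ (by omega)

omit [IsDomain S] in
/-- `1 + ϖ^n t` is a unit when `ϖ` lies in the maximal ideal of the local ring `S`. -/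
theorem isUnit_one_add_pow_mul [IsLocalRing S] {ϖ : S} (hϖm : ϖ ∈ IsLocalRing.maximalIdeal S)
    {n : ℕ} (hn : 1 ≤ n) (t : S) : IsUnit (1 + ϖ ^ n * t) := by
  have hm : ϖ ^ n * t ∈ IsLocalRing.maximalIdeal S := by
    refine Ideal.mul_mem_right _ _ (Ideal.pow_mem_of_mem _ hϖm n (by omega))
  by_contra hnot
  have : 1 + ϖ ^ n * t ∈ IsLocalRing.maximalIdeal S := by
    rwa [IsLocalRing.mem_maximalIdeal, mem_nonunits_iff]
  have := Ideal.sub_mem _ this hm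
  simp at this

/-- THE APPROXIMATION: under residue-level norm surjectivity (`hres`, giving `n = 1`) and trace
surjectivity (`htr`), for every `σ`-fixed `u` and every `n ≥ 1` there is a UNIT `x` with
`N x ≡ u (mod ϖ^n)`. -/
theorem exists_units_normConj_sub_dvd [IsLocalRing S] (hσσ : ∀ s, σ (σ s) = s) {ϖ : S}
    (hϖ : σ ϖ = ϖ) (hϖ0 : ϖ ≠ 0) (hϖm : ϖ ∈ IsLocalRing.maximalIdeal S)
    (htr : ∀ c : S, σ c = c → ∃ t : S, ϖ ∣ (t + σ t) - c)
    {u : S} (hu : σ u = u) (hres : ∃ x : Sˣ, ϖ ∣ normConj σ (x : S) - u) :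
    ∀ n : ℕ, 1 ≤ n → ∃ x : Sˣ, ϖ ^ n ∣ normConj σ (x : S) - u := by
  intro n hn
  induction n with
  | zero => omega
  | succ m ih =>
    rcases Nat.eq_zero_or_pos m with hm | hm
    · subst hm; simpa using hres
    · obtain ⟨x, hx⟩ := ih hm
      obtain ⟨t, ht⟩ := exists_mul_one_add_normConj_sub_dvd_succ σ hσσ hϖ hϖ0 htr hu x hm hx
      exact ⟨x * (isUnit_one_add_pow_mul hϖm hm t).unit, by simpa using ht⟩

end Step

end Summit.Ventures.HodgeRepro2.T5UnramifiedNormApprox
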